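import Summits.Ventures.PercRepro.ProfileFlatUpsetDrop
import Summits.Ventures.PercRepro.ProfileFlatUpsetSmallPrincipal
import Summits.Ventures.PercRepro.ProfileFlatUpsetCorankTwo

/-!
# PercRepro — THE REDUCTION OF (G) ON `2r − 2` POINTS TO THE SPANNED CLASS `(B) ∪ (D)` OF A POINT `e ∈ F₀`
(p10, gen 19; `proofs/P10-AVFULL.md` §27(j))

`M` of rank `r` on `N = 2r − 2` points, `F₀` a flat of ANY rank, `U = principalUp M F₀`, `e ∈ F₀`.  The `e`-classes of
the drop module (109th): `sepA` is EMPTY (`e ∈ F₀ ⊆ cl Z` for every separated `Z`; `sepA_principal_eq_empty`), and on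
`sepC = {Z : e ∈ Z, e ∉ cl (E ∖ Z)}` the map `Z ↦ (E ∖ Z) ∪ e` injects the negative sets (`#Z = r − 1`) into the
positive ones (`#Z = r`): `(E ∖ Z) ∪ e` is a basis with complement `Z ∖ e`, which misses `e ∈ F₀`
(`insert_sdiff_mem_posC`, `card_negC_le_card_posC`).  Hence `sum_sepC_nonneg`: the class `(C)` has non-negative
weight, and THE REDUCTION `sum_sepSets_principal_nonneg_of_sepBD`: (G) at `↑F₀` on `2r − 2` points follows from the
non-negativity of the spanned class `(B) ∪ (D) = {Z : e ∈ cl (E ∖ Z)}` alone.  Census (own, n = 8): `(B) ∪ (D)` is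
non-negative for every `e ∈ F₀` in every instance with `rk F₀ ≤ r − 3` (13,986 at `t = 3`, 1,952 at `t = 4`) — the
open part of (G) at principal up-sets is exactly this statement.  Nothing here asserts (G) in general.
-/

open scoped Matroid

namespace PercRepro.Cogirth

open Finset ThmH Skew

variable {α : Type} [DecidableEq α] {M : Matroid α} [M.Finite]

/-! ### The sizes on `2r − 2` points (any rank of `F₀`) -/

/-- On `2r − 2` points a separated set of a principal up-set has `#Z = r − 1` or `#Z = r`. -/
theorem card_of_mem_sepSets_principal_two_mul {F₀ : Finset α} (hF : IsFlatF M F₀)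
    (hN : (gr M).card + 2 = 2 * rk M (gr M)) {Z : Finset α} (hZ : Z ∈ sepSets M (principalUp M F₀)) :
    Z.card + 1 = rk M (gr M) ∨ Z.card = rk M (gr M) := by
  obtain ⟨_, h2, h3⟩ := bounds_of_mem_sepSets_principal hF hZ
  have hZr : rk M Z = Z.card := (mem_biIndepAll.1 (mem_sepSets.1 hZ).1).2.1
  have hZg : Z ⊆ gr M := (mem_biIndepAll.1 (mem_sepSets.1 hZ).1).1
  have h4 : Z.card ≤ rk M (gr M) := by have := rk_mono_fu (M := M) hZg; rwa [hZr] at this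
  omega

/-! ### The class `(A)` is empty -/

/-- For `e ∈ F₀` no separated set of `principalUp M F₀` avoids `e` in its closure: `sepA = ∅`. -/
theorem sepA_principal_eq_empty {F₀ : Finset α} {e : α} (he : e ∈ F₀) :
    sepA M (principalUp M F₀) e = ∅ := by
  rw [eq_empty_iff_forall_notMem]
  intro Z hZ
  unfold sepA at hZ
  rw [mem_filter] at hZ
  exact hZ.2.2 ((subset_clF_of_mem_sepSets_principal hZ.1).1 he)

/-! ### The injection on the class `(C)` -/

/-- The negative sets of the class `(C)`. -/
noncomputable def negC (M : Matroid α) [M.Finite] (F₀ : Finset α) (e : α) : Finset (Finset α) :=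
  (sepC M (principalUp M F₀) e).filter (fun Z => Z.card + 1 = rk M (gr M))

/-- The positive sets of the class `(C)`. -/
noncomputable def posC (M : Matroid α) [M.Finite] (F₀ : Finset α) (e : α) : Finset (Finset α) :=
  (sepC M (principalUp M F₀) e).filter (fun Z => Z.card = rk M (gr M))

/-- For `Z` negative in `(C)`, `(E ∖ Z) ∪ e` is positive in `(C)`. -/
theorem insert_sdiff_mem_posC {F₀ : Finset α} (hF : IsFlatF M F₀) (hN : (gr M).card + 2 = 2 * rk M (gr M))
    {e : α} (he : e ∈ F₀) {Z : Finset α} (hZ : Z ∈ negC M F₀ e) : insert e (gr M \ Z) ∈ posC M F₀ e := by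
  unfold negC at hZ
  rw [mem_filter] at hZ
  obtain ⟨hZc, hc⟩ := hZ
  unfold sepC at hZc
  rw [mem_filter] at hZc
  obtain ⟨hZs, heZ, hecl⟩ := hZc
  obtain ⟨hin, _⟩ := subset_clF_of_mem_sepSets_principal hZs
  obtain ⟨_, _, hsum⟩ := bounds_of_mem_sepSets_principal hF hZs
  have hZb := (mem_sepSets.1 hZs).1
  obtain ⟨hZg, hZr, hZcr⟩ := mem_biIndepAll.1 hZb
  have heg : e ∈ gr M := hZg heZ
  have henot : e ∉ gr M \ Z := fun h => (mem_sdiff.1 h).2 heZ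
  -- `(E ∖ Z) ∪ e` is independent of size `r`
  have hW : rk M (insert e (gr M \ Z)) = (insert e (gr M \ Z)).card :=
    rk_insert_eq_card_of_notMem_clF heg sdiff_subset hZcr henot hecl
  have hWc : (insert e (gr M \ Z)).card = rk M (gr M) := by rw [card_insert_of_notMem henot]; omega
  -- its complement is `Z ∖ e`
  have hcomp : gr M \ insert e (gr M \ Z) = Z.erase e := by
    ext y
    simp only [mem_sdiff, mem_insert, mem_erase, not_or, not_and, not_not]
    constructor
    · rintro ⟨hy, hye, h⟩; exact ⟨hye, h hy⟩
    · rintro ⟨hye, hy⟩; exact ⟨hZg hy, hye, fun _ => hy⟩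
  have hecl' : e ∉ clF M (Z.erase e) := notMem_clF_erase_of_rk_eq_card heg hZg hZr heZ
  unfold posC sepC
  rw [mem_filter, mem_filter, mem_sepSets, mem_biIndepAll]
  refine ⟨⟨⟨⟨insert_subset heg sdiff_subset, hW, ?_⟩, ?_, ?_⟩, mem_insert_self e _, ?_⟩, hWc⟩
  · rw [hcomp]; exact rk_eq_card_of_subset_of_rk_eq_card (erase_subset e Z) hZr
  · -- a basis: its closure is the ground set, which contains `F₀`
    have hr : rk M (insert e (gr M \ Z)) = rk M (gr M) := by rw [hW, hWc]
    rw [clF_eq_gr_of_rk_eq (insert_subset heg sdiff_subset) hr]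
    exact (mem_principalUp).2 ⟨Subset.refl _, ⟨Subset.refl _, Subset.antisymm (clF_subset_gr_fu _)
      (subset_clF_fu (Subset.refl _))⟩, hF.1⟩
  · rw [hcomp]
    intro hcon
    rw [mem_principalUp] at hcon
    exact hecl' (hcon.2.2 he)
  · rw [hcomp]; exact hecl'

/-- The injection `Z ↦ (E ∖ Z) ∪ e` on the negative sets of `(C)`. -/
theorem card_negC_le_card_posC {F₀ : Finset α} (hF : IsFlatF M F₀) (hN : (gr M).card + 2 = 2 * rk M (gr M))
    {e : α} (he : e ∈ F₀) : (negC M F₀ e).card ≤ (posC M F₀ e).card := by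
  apply card_le_card_of_injOn (fun Z => insert e (gr M \ Z))
  · intro Z hZ
    exact insert_sdiff_mem_posC hF hN he hZ
  · intro Z₁ hZ₁ Z₂ hZ₂ heq
    have heq' : insert e (gr M \ Z₁) = insert e (gr M \ Z₂) := heq
    have key : ∀ Z ∈ negC M F₀ e, ∀ y, y ∈ Z ↔ y ∈ gr M ∧ y ∉ (insert e (gr M \ Z)).erase e := by
      intro Z hZ y
      unfold negC sepC at hZ
      rw [mem_filter, mem_filter] at hZ
      have hZg : Z ⊆ gr M := (mem_biIndepAll.1 (mem_sepSets.1 hZ.1.1).1).1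
      have henot : e ∉ gr M \ Z := fun h => (mem_sdiff.1 h).2 hZ.1.2.1
      rw [erase_insert henot, mem_sdiff]
      constructor
      · intro hy; exact ⟨hZg hy, fun h => h.2 hy⟩
      · rintro ⟨hy, h⟩; by_contra hyZ; exact h ⟨hy, hyZ⟩
    ext y
    rw [key Z₁ hZ₁ y, key Z₂ hZ₂ y, heq']

/-- The class `(C)` has non-negative weight on `2r − 2` points. -/
theorem sum_sepC_nonneg {F₀ : Finset α} (hF : IsFlatF M F₀) (hN : (gr M).card + 2 = 2 * rk M (gr M)) {e : α}
    (he : e ∈ F₀) : 0 ≤ ∑ Z ∈ sepC M (principalUp M F₀) e, (2 * (Z.card : ℤ) - (gr M).card - 1) := by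
  have hterm : ∀ Z ∈ sepC M (principalUp M F₀) e, 2 * (Z.card : ℤ) - (gr M).card - 1 =
      (if Z ∈ posC M F₀ e then 1 else 0 : ℤ) - (if Z ∈ negC M F₀ e then 1 else 0) := by
    intro Z hZ
    have hZs : Z ∈ sepSets M (principalUp M F₀) := (mem_filter.1 hZ).1
    have hN' : ((gr M).card : ℤ) + 2 = 2 * rk M (gr M) := by exact_mod_cast hN
    rcases card_of_mem_sepSets_principal_two_mul hF hN hZs with h | h
    · have hn : Z ∈ negC M F₀ e := by unfold negC; exact mem_filter.2 ⟨hZ, h⟩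
      have hp : Z ∉ posC M F₀ e := fun hp => by unfold posC at hp; have := (mem_filter.1 hp).2; omega
      rw [if_neg hp, if_pos hn]
      have h' : (Z.card : ℤ) + 1 = rk M (gr M) := by exact_mod_cast h
      linarith
    · have hp : Z ∈ posC M F₀ e := by unfold posC; exact mem_filter.2 ⟨hZ, h⟩
      have hn : Z ∉ negC M F₀ e := fun hn => by unfold negC at hn; have := (mem_filter.1 hn).2; omega
      rw [if_pos hp, if_neg hn]
      have h' : (Z.card : ℤ) = rk M (gr M) := by exact_mod_cast h
      linarith
  rw [sum_congr rfl hterm, sum_sub_distrib, sum_boole, sum_boole]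
  have hP : (sepC M (principalUp M F₀) e).filter (fun Z => Z ∈ posC M F₀ e) = posC M F₀ e := by
    ext Z; rw [mem_filter]; exact ⟨fun h => h.2, fun h => ⟨(mem_filter.1 h).1, h⟩⟩
  have hN' : (sepC M (principalUp M F₀) e).filter (fun Z => Z ∈ negC M F₀ e) = negC M F₀ e := by
    ext Z; rw [mem_filter]; exact ⟨fun h => h.2, fun h => ⟨(mem_filter.1 h).1, h⟩⟩
  rw [hP, hN']
  have h := card_negC_le_card_posC hF hN he
  have h' : ((negC M F₀ e).card : ℤ) ≤ (posC M F₀ e).card := by exact_mod_cast h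
  linarith

/-! ### The reduction -/

/-- **THE REDUCTION**: on `2r − 2` points, (G) at `↑F₀` follows from the non-negativity of the spanned class
`(B) ∪ (D)` of any point `e ∈ F₀`. -/
theorem sum_sepSets_principal_nonneg_of_sepBD {F₀ : Finset α} (hF : IsFlatF M F₀)
    (hN : (gr M).card + 2 = 2 * rk M (gr M)) {e : α} (he : e ∈ F₀)
    (hBD : 0 ≤ ∑ Z ∈ sepB M (principalUp M F₀) e, (2 * (Z.card : ℤ) - (gr M).card - 1) +
      ∑ Z ∈ sepD M (principalUp M F₀) e, (2 * (Z.card : ℤ) - (gr M).card - 1)) :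
    0 ≤ ∑ Z ∈ sepSets M (principalUp M F₀), (2 * (Z.card : ℤ) - (gr M).card - 1) := by
  rw [sum_sepSets_eq_classes (principalUp M F₀) e, sepA_principal_eq_empty he, sum_empty]
  have hC := sum_sepC_nonneg hF hN he
  linarith

end PercRepro.Cogirth
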